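/-
Copyright (c) 2026 the pub-hodgecm-mathlib formalisation cell (harness21).  Prover seat hodgecm-mathlib-LH4-p15 (g2), req620 Track A «(D-RAM) FOUR-FRAME» squad
(STAGE-1b, row (2) of the piece `f_{T₊}`, the (β₂) road (R-36) «PURE-CELL LEDGER»; β₂ sub-dealer LH4-p04 (g10) WORD #24 letter ‹TERM.letter.v2›, holder LH4-p15: the per-vertex
letter of the terminal cell), 2026-09-05.
-/
import Summits.HodgeConjecture.HodgeConjecture.Theorems.F0P3cDyRamRayScalarNearlyFixed      -- ★ p863048 (LH4-p16 (g2)): Steps A–B (`v_map_add_mul_map_le`, `v_add_map_le_of_map_le`, `cellScalar_eq_dualGen_mul`, `add_map_div_eq_sub_map_div`); brings ★ HEAD B, ★ (S0″), ★ `exists_fixed_unit_sub_mul_refSkew_le_any`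
import Summits.HodgeConjecture.HodgeConjecture.Theorems.F0P3cDyRamNormFormRayOfTrace          -- ★ p863638 (LH7-p09 (g2)): `normFormSet_eq_ray_of_line_sizes` (the ray WITHOUT ray domination); brings ★ `…ShellLineModel`
import Literature.NumberTheory.LocalFields.WildQuadraticDatumTraceBound                      -- ★ Lit: `trace_bound_pow_of_isRamifiedQuadraticDatum` (`|x + σx| ≤ |ϖ|^{d−1}|x|`)
import HarnessLib

/-!
# Crux `H413`, line LH4 «(D-RAM) FOUR-FRAME» — STAGE-1b, row (2), the (β₂) road (R-36), row (ROW-TERM)′: «THE RAY DICHOTOMY OF A ROW VERTEX» — the level digit and the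
# label of a glued vertex over a cone-cell member are BOTH read off ONE scalar, the ray scalar `e₀` (`jE e₀ = Tr_ρ(μ∕D₀)`): `|e₀| ≤ |ϖ|` ⟹ `(Γ − 1)·L ⊆ ϖ·L` (off every
# `(0, m)`-shell); `|e₀| = |ϖ|^{ℓ₀}` ⟹ level `0`, NOT level `1`, and the census letter is `valueSetMod σ ϖ m* (e′ • X₊)` for a `σ`-fixed unit `e′` — from SIZES, no ray domination

Cell `hodgecm-mathlib` (D-0151), FLOOR 0, crux item H413 = `stmt-HodgeConjecture-24833`, route of record `HCCMUnconditional`; squad F0∕P3c∕LH4; lane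
`--supports stmt-HodgeConjecture-24833 --as helper` (count-neutral; pays NO tier-0 row).  THEOREMS ONLY (no `def`, no instance, no notation, no `sorry`, default heartbeats);
★-only imports; states NO law; (β₂) stays a HYPOTHESIS.  DATUM-FREE: ★ p861372 HEAD B's frame (plane `(E², H₂)`, block form `block(H₂, h_W)`, `Γ = endoGL (γ₂, u)`, ★ (C1)'s line
model `(M, jE, ρ, Θ, α; φ, lam, h_M)`, an integral vertex `L` glued over `(B₂, w₀, g₀)`, `Λ = x₀·𝒪_cc`, `φ w₀ = Y⁻¹x₀`, `Y = dualGen ρ Θ α cc h_M x₀`), the sheet datum on `E`.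

WHY (β₂ WORD #24: ‹TERM.letter.v2› = «the off-diagonal TERMINAL cell `j + b = jl` of the live row `2b = m` contributes `0`»; this seat 00:41:53Z (T-a)).  LH4-p16's ★ HEAD
`…RayScalarNearlyFixed.exists_fixed_unit_valueSet_endoGL_sub_one_glued_eq_smul_xPlus` labels every NON-terminal row vertex: it needs RAY DOMINATION at the modulus `m*`
(`μ = ϖE^{m′}·μ̃`, `μ̃ ∈ 𝒪_cc`, `m′ ≥ m*`), which on the terminal cell (conductor `cc = ϖE^{b+δ}`) only holds for `b ≥ m*`, and the row reading `|e₀| = |ϖ|^{ℓ₀}`, which FAILS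
there for one top digit in `q` (the `X`-members: `|e₀| < 1`, cf. ★ p862572 at `q = 2` where every member is one).  LH7-p09's ★ p863638 `normFormSet_eq_ray_of_line_sizes` removes
the first obstruction: the norm-form letter is the `a`-ray as soon as three μ-currency SIZES hold (`g1 g2 g3`; on the row at `d = 2` all three read `2 ≤ b`, i.e. `4 ≤ m`).  The
second obstruction is a genuine DICHOTOMY, and both branches are read off `e₀` through the exact identity `jE e₀ = (μ∕Y − ρ(μ∕Y))∕(Θcc·Θ(α − ρα))` (★ p863048 §1:
`D₀ = Y·Θcc·Θ(α − ρα)` with `Θ(α − ρα)` anti-`ρ`-fixed), so that **`|jE e₀|·|cc(α − ρα)| = |μ∕Y − ρ(μ∕Y)|`** (§1) — the anti-invariant part of the DEPTH QUOTIENT `μ∕Y`, i.e. the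
third clause of ★ `…ShellLineModel.latticeInLevel_endoGL_sub_one_iff_isOrd`:
* §2 (X) `latticeInLevel_one_endoGL_sub_one_of_v_rayScalar_le` — `|e₀| ≤ |ϖ|` (+ `|u₀₀ − 1| ≤ |ϖ|`, `|μ| ≤ |ϖE|`, `|μ − ρμ| ≤ |cc(α − ρα)|·|ϖE|`, `|μ∕Y| ≤ |ϖE|`) ⟹
  `LatticeInLevel ϖ 1 (Γ − 1) L`, hence `¬ LatticeNearTransvShell ϖ 0 m (Γ − 1) L` for every `m` (`not_latticeNearTransvShell_zero_of_v_rayScalar_le`) — ★ p862572 §3 with its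
  `#𝓀[E] = 2` digit replaced by the hypothesis `|e₀| ≤ |ϖ|`;
* §3 (L, level) `latticeInLevel_zero_endoGL_sub_one_of_isOrd` (level `0` from `lam ∈ 𝒪_cc` and the population token `μ∕Y ∈ 𝒪_cc`) and
  `not_latticeInLevel_one_endoGL_sub_one_of_v_rayScalar_eq_one` (`|e₀| = 1` ⟹ NOT level `1`);
* §4 (L, label) HEAD `exists_fixed_unit_valueSet_eq_smul_xPlus_of_sizes` — p16's ★ HEAD VERBATIM in frame and conclusion, with the ray-domination letters `hμ hμt hmm`
  REPLACED by `hjiso`, `hYb : |Y| = |ϖE|^b` and the three sizes `g1 g2 g3` at `m*` (p16's `hP he₀ he₀v hn hlamn hun hsk` KEPT — on the terminal cell `he₀v` is the branch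
  hypothesis, not a consequence; this is the difference with LH7-p09's FILE 13, whose `hμle : |μ| ≤ |ϖE|^{2b+ℓ₀+1}` is the lower line strictly BELOW the row).
WHAT IS NOT CLAIMED: which vertices have `|e₀| = 1` (the digit count), the affine shape of `e′` in the cell coordinate, any census identity.
HONEST LABEL.  Count-neutral valuation ∕ lattice algebra; nothing printed is asserted; no census law is stated; ‹TERM.v2› stays OPEN; `HC_CM` is proved only modulo the 7
printed citations (2 remaining named inputs: hLiu418 = `stmt-HodgeConjecture-24832`, h413 = `stmt-HodgeConjecture-24833`) until rung 0 closes.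
## References
* [Kottwitz1986BaseChangeUnits] R. E. Kottwitz, *Base change for unit elements of Hecke algebras*, Compositio Math. 60 (1986): §1 pp. 240–241, §3 (congruence levels of fixed lattices).
* [Rogawski1990] J. D. Rogawski, *Automorphic Representations of Unitary Groups in Three Variables*, Ann. of Math. Stud. 123 (1990): §4.9 Prop. 4.9.1 (b) p. 55.
* [Jacobowitz1962] R. Jacobowitz, *Hermitian forms over local fields*, Amer. J. Math. 84 (1962): §4 (dual lattices, gluing).
* [Serre1979] J.-P. Serre, *Local Fields*, GTM 67 (1979): Ch. I §6 Prop. 18, Ch. III §3 Prop. 7, §6 Prop. 12, Ch. V §3 Cor. 3.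
-/

set_option autoImplicit false

noncomputable section

namespace Summit.HodgeConjecture.HodgeConjecture.Cruxes.H413.F0P3cDyRamRowVertexRayDichotomy

open scoped Valued WithZero Matrix MatrixGroups
open WithZero
open Literature.NumberTheory.Automorphic Literature.NumberTheory.Automorphic.HermitianLattice Literature.NumberTheory.Automorphic.UnitaryLatticeTree
open Literature.NumberTheory.Automorphic.UnitaryThreeFourFrame (IsRamifiedQuadraticDatum)
open Literature.NumberTheory.LocalFields.WildQuadraticDatum (trace_bound_pow_of_isRamifiedQuadraticDatum)
open Literature.NumberTheory.Rogawski1990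
open Summit.HodgeConjecture.HodgeConjecture.Cruxes.H413.F0P3cDyRamFourFramePieces
open Summit.HodgeConjecture.HodgeConjecture.Cruxes.H413.F0P3cDyRamFourFrameCensusDefs (LatticeInLevel LatticeNearTransvShell)
open Summit.HodgeConjecture.HodgeConjecture.Cruxes.H413.F0P3cDyRamToricCensusDefs
open Summit.HodgeConjecture.HodgeConjecture.Cruxes.H413.F0P3cDyRamShellLineModel (latticeInLevel_endoGL_sub_one_iff_isOrd)
open Summit.HodgeConjecture.HodgeConjecture.Cruxes.H413.F0P3cDyRamDepthFormLineModel (valueSet_endoGL_sub_one_glued_eq_normFormSet_of_gen)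
open Summit.HodgeConjecture.HodgeConjecture.Cruxes.H413.F0P3cDyRamNormFormRayOfTrace (normFormSet_eq_ray_of_line_sizes)
open Summit.HodgeConjecture.HodgeConjecture.Cruxes.H413.F0P3cDyRamLabelShellFlipCardTwo (v_refSkew_eq valueSetMod_smul_xPlus_eq_of_v_sub_le_pred)
open Summit.HodgeConjecture.HodgeConjecture.Cruxes.H413.F0P3cDyRamDiagonalCellCleanRegime (v_map_le_pow_iff)
open Summit.HodgeConjecture.HodgeConjecture.Cruxes.H413.F0P3cDyRamCleanELetterRamM (exists_fixed_unit_sub_mul_refSkew_le_any)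
open Summit.HodgeConjecture.HodgeConjecture.Cruxes.H413.F0P3cDyRamRayScalarNearlyFixed (v_map_add_mul_map_le v_add_map_le_of_map_le cellScalar_eq_dualGen_mul
  add_map_div_eq_sub_map_div)

variable {E M : Type} [Field E] [Valued E ℤᵐ⁰] [Field M] [Valued M ℤᵐ⁰] {ρ Θ : M →+* M} {α : M}

/-! ## §1 The ray scalar IS the anti-invariant part of the depth quotient -/

omit [Field E] [Valued E ℤᵐ⁰] [Valued M ℤᵐ⁰] in
/-- **`jE e₀ = (μ∕Y − ρ(μ∕Y))∕(Θcc·Θ(α − ρα))`**: `D₀ = cc(α − ρα)·ΘY = Y·Θcc·Θ(α − ρα)` (`Θh = h`, `Θ² = 1`) and `Θ(α − ρα)` is anti-`ρ`-fixed, `Θcc` is `ρ`-fixed, so the `ρ`-trace of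
`μ∕D₀ = (μ∕Y)∕(Θcc·Θ(α − ρα))` is the skew part of `μ∕Y` over that scalar. [cite: Jacobowitz1962, §4] [cite: Serre1979, Ch. III §3 Prop. 7] -/
theorem rayScalar_eq_sub_map_div (hρρ : ∀ x, ρ (ρ x) = x) (hΘΘ : ∀ x, Θ (Θ x) = x) (hΘρ : ∀ x, Θ (ρ x) = ρ (Θ x))
    {cc hM x₀ : M} (hc : ρ cc = cc) (hΘh : Θ hM = hM) (μ : M) :
    μ / (cc * (α - ρ α) * Θ (dualGen ρ Θ α cc hM x₀)) + ρ (μ / (cc * (α - ρ α) * Θ (dualGen ρ Θ α cc hM x₀))) =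
      (μ / dualGen ρ Θ α cc hM x₀ - ρ (μ / dualGen ρ Θ α cc hM x₀)) / (Θ cc * Θ (α - ρ α)) := by
  have hc' : ρ (Θ cc) = Θ cc := by rw [← hΘρ, hc]
  have hA : ρ (Θ (α - ρ α)) = -Θ (α - ρ α) := by rw [← hΘρ, map_sub ρ, hρρ, ← map_neg, neg_sub]
  have e : μ / (cc * (α - ρ α) * Θ (dualGen ρ Θ α cc hM x₀)) = μ / dualGen ρ Θ α cc hM x₀ / (Θ cc * Θ (α - ρ α)) := by
    rw [cellScalar_eq_dualGen_mul hΘΘ hΘh cc x₀, div_mul_eq_div_div]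
  rw [e, add_map_div_eq_sub_map_div ρ hc' hA]

omit [Valued E ℤᵐ⁰] in
/-- **`|jE e₀|·|cc(α − ρα)| = |μ∕Y − ρ(μ∕Y)|`** (`Θ` isometric, `cc(α − ρα) ≠ 0`). [cite: Serre1979, Ch. III §3 Prop. 7; §6 Prop. 12] -/
theorem v_rayScalar_mul_eq (hρρ : ∀ x, ρ (ρ x) = x) (hΘΘ : ∀ x, Θ (Θ x) = x) (hΘρ : ∀ x, Θ (ρ x) = ρ (Θ x)) (hvΘ : ∀ x, Valued.v (Θ x) = Valued.v x)
    {cc hM x₀ : M} (hc : ρ cc = cc) (hcc : cc * (α - ρ α) ≠ 0) (hΘh : Θ hM = hM) (jE : E →+* M) {μ : M} {e₀ : E}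
    (he₀ : jE e₀ = μ / (cc * (α - ρ α) * Θ (dualGen ρ Θ α cc hM x₀)) + ρ (μ / (cc * (α - ρ α) * Θ (dualGen ρ Θ α cc hM x₀)))) :
    Valued.v (jE e₀) * Valued.v (cc * (α - ρ α)) = Valued.v (μ / dualGen ρ Θ α cc hM x₀ - ρ (μ / dualGen ρ Θ α cc hM x₀)) := by
  have hΘcc : Valued.v (Θ cc * Θ (α - ρ α)) = Valued.v (cc * (α - ρ α)) := by rw [← map_mul, hvΘ]
  have hpos : Valued.v (Θ cc * Θ (α - ρ α)) ≠ 0 := by rw [hΘcc]; exact (Valuation.ne_zero_iff _).2 hcc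
  rw [he₀, rayScalar_eq_sub_map_div hρρ hΘΘ hΘρ hc hΘh μ, map_div₀, hΘcc, div_mul_cancel₀ _ (hΘcc ▸ hpos)]

/-! ## §2 (X) A small ray scalar puts the vertex on level `1`, off every `ℓ₀ = 0` shell -/

/-- **(X) «A VERTEX WITH `|e₀| ≤ |ϖ|` IS ON LEVEL `1`».**  Frame: ★ `…ShellLineModel.latticeInLevel_endoGL_sub_one_iff_isOrd`'s glued-vertex letters VERBATIM (plane `E`,
`|ϖ| = exp(−1)`, line model `(M, jE, ρ, Θ, α; φ, lam)`, vertex `L` with tube `b` over `(B₂, w₀, g₀)`, `Λ = φ(B₂) = x₀·𝒪_cc`, `φ w₀ = Y⁻¹x₀`, `Y = dualGen ρ Θ α cc h_M x₀`) + `Θ`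
an isometric involution commuting with `ρ`, `Θh_M = h_M`, `ρcc = cc`, `cc(α − ρα) ≠ 0`, `|jE c| ≤ 1 ↔ |c| ≤ 1`; LETTERS: `|u₀₀ − 1| ≤ |ϖ|`, `|μ| ≤ |ϖE|`,
`|μ − ρμ| ≤ |cc(α − ρα)|·|ϖE|`, `|μ∕Y| ≤ |ϖE|` (`μ = lam − jE u₀₀`), the ray scalar `jE e₀ = Tr_ρ(μ∕(cc(α − ρα)·ΘY))` with **`|e₀| ≤ |ϖ|`**.  THEN
`LatticeInLevel ϖ 1 (Γ − 1) L`. [cite: Kottwitz1986BaseChangeUnits, §3] [cite: Serre1979, Ch. III §6 Prop. 12] [cite: Jacobowitz1962, §4] -/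
theorem latticeInLevel_one_endoGL_sub_one_of_v_rayScalar_le
    (hρρ : ∀ x, ρ (ρ x) = x) (hvρ : ∀ x, Valued.v (ρ x) = Valued.v x) (hΘΘ : ∀ x, Θ (Θ x) = x) (hΘρ : ∀ x, Θ (ρ x) = ρ (Θ x))
    (hvΘ : ∀ x, Valued.v (Θ x) = Valued.v x) {ϖ : E} (hϖ : Valued.v ϖ = exp (-1 : ℤ))
    (jE : E →+* M) (hjv : ∀ c, Valued.v (jE c) ≤ 1 ↔ Valued.v c ≤ 1) (hjfix : ∀ z, ρ z = z ↔ ∃ c, jE c = z)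
    (φ : (Fin 2 → E) →+ M) (hφs : ∀ (c : E) (x : Fin 2 → E), φ (c • x) = jE c * φ x) (hφi : Function.Injective φ)
    {γ₂ : GL (Fin 2) E} {lam hM : M} (hφγ : ∀ x, φ ((γ₂ : Matrix (Fin 2) (Fin 2) E) *ᵥ x) = lam * φ x) (hhM : hM ≠ 0) (hΘh : Θ hM = hM)
    {L : Submodule 𝒪[E] (Fin 3 → E)} {b : ℕ} (hb : ∀ a : E, (Pi.single 1 a : Fin 3 → E) ∈ L ↔ Valued.v a ≤ Valued.v ϖ ^ b)
    (hpr : ∀ x ∈ L, Valued.v (x 1) * Valued.v ϖ ^ b ≤ 1)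
    {B₂ : Submodule 𝒪[E] (Fin 2 → E)} {w₀ : Fin 2 → E} {g₀ : Fin 3 → E}
    (hB : B₂.map ((Matrix.toLin' (!![1, 0; 0, 0; 0, 1] : Matrix (Fin 3) (Fin 2) E)).restrictScalars 𝒪[E]) =
      L ⊓ LinearMap.ker ((LinearMap.proj (1 : Fin 3) : (Fin 3 → E) →ₗ[E] E).restrictScalars 𝒪[E]))
    (hg₀ : g₀ ∈ L) (hg₀1 : Valued.v (g₀ 1) * Valued.v ϖ ^ b = 1) (hprg : g₀ - Pi.single 1 (g₀ 1) = ![w₀ 0, 0, w₀ 1])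
    {Λ : AddSubgroup M} (hBΛ : B₂.toAddSubgroup.map φ = Λ) {cc x₀ : M} (hc : ρ cc = cc) (hcc : cc * (α - ρ α) ≠ 0) (hx₀ : x₀ ≠ 0)
    (hΛx : ∀ x, x ∈ Λ ↔ ∃ z, IsOrd ρ α cc z ∧ x = x₀ * z) (hw₀Y : φ w₀ = (dualGen ρ Θ α cc hM x₀)⁻¹ * x₀)
    (u : GL (Fin 1) E) (hu1 : Valued.v ((u : Matrix (Fin 1) (Fin 1) E) 0 0 - 1) ≤ Valued.v ϖ)
    (hμ1 : Valued.v (lam - jE ((u : Matrix (Fin 1) (Fin 1) E) 0 0)) ≤ Valued.v (jE ϖ))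
    (hanti1 : Valued.v ((lam - jE ((u : Matrix (Fin 1) (Fin 1) E) 0 0)) - ρ (lam - jE ((u : Matrix (Fin 1) (Fin 1) E) 0 0))) ≤
      Valued.v (cc * (α - ρ α)) * Valued.v (jE ϖ))
    (hμY1 : Valued.v ((lam - jE ((u : Matrix (Fin 1) (Fin 1) E) 0 0)) / dualGen ρ Θ α cc hM x₀) ≤ Valued.v (jE ϖ))
    {e₀ : E} (he₀ : jE e₀ = (lam - jE ((u : Matrix (Fin 1) (Fin 1) E) 0 0)) / (cc * (α - ρ α) * Θ (dualGen ρ Θ α cc hM x₀)) +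
      ρ ((lam - jE ((u : Matrix (Fin 1) (Fin 1) E) 0 0)) / (cc * (α - ρ α) * Θ (dualGen ρ Θ α cc hM x₀))))
    (he₀le : Valued.v e₀ ≤ Valued.v ϖ) :
    LatticeInLevel ϖ 1 ((((endoGL (γ₂, u) : GL (Fin 3) E) : Matrix (Fin 3) (Fin 3) E) - 1)) L := by
  set Y : M := dualGen ρ Θ α cc hM x₀ with hYdef
  set μ : M := lam - jE ((u : Matrix (Fin 1) (Fin 1) E) 0 0) with hμdef
  have hvϖ0 : Valued.v ϖ ≠ 0 := by rw [hϖ]; exact exp_ne_zero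
  have hϖ0 : ϖ ≠ 0 := fun h0 => hvϖ0 (by rw [h0, map_zero])
  have hjϖ0 : jE ϖ ≠ 0 := (map_ne_zero jE).2 hϖ0
  have hvjϖ0 : Valued.v (jE ϖ) ≠ 0 := (Valuation.ne_zero_iff _).2 hjϖ0
  have hvjϖpos : 0 < Valued.v (jE ϖ) := zero_lt_iff.2 hvjϖ0
  have hρϖ : ρ (jE ϖ) = jE ϖ := (hjfix _).2 ⟨ϖ, rfl⟩
  have hρu : ρ (jE ((u : Matrix (Fin 1) (Fin 1) E) 0 0)) = jE ((u : Matrix (Fin 1) (Fin 1) E) 0 0) := (hjfix _).2 ⟨_, rfl⟩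
  have hY0 : Y ≠ 0 := by
    rw [hYdef, dualGen_def]; exact mul_ne_zero (mul_ne_zero hhM (mul_ne_zero hx₀ ((map_ne_zero Θ).2 hx₀))) hcc
  -- `|jE e₀| ≤ |jE ϖ|`, hence `|μ∕Y − ρ(μ∕Y)| ≤ |cc(α − ρα)|·|jEϖ|`
  have hje₀ : Valued.v (jE e₀) ≤ Valued.v (jE ϖ) := by
    have h := v_map_le_pow_iff jE hjv hϖ0 e₀ 1
    rw [pow_one, pow_one] at h
    exact h.2 he₀le
  have hsk : Valued.v (μ / Y - ρ (μ / Y)) ≤ Valued.v (cc * (α - ρ α)) * Valued.v (jE ϖ) := by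
    rw [← v_rayScalar_mul_eq hρρ hΘΘ hΘρ hvΘ hc hcc hΘh jE he₀, mul_comm]
    exact mul_le_mul_right hje₀ _
  -- the jE-transport of `|u₀₀ − 1| ≤ |ϖ|`
  have hjum : Valued.v (jE ((u : Matrix (Fin 1) (Fin 1) E) 0 0) - 1) ≤ Valued.v (jE ϖ) := by
    have h := v_map_le_pow_iff jE hjv hϖ0 (((u : Matrix (Fin 1) (Fin 1) E) 0 0) - 1) 1
    rw [pow_one, pow_one, map_sub, map_one] at h
    exact h.2 hu1
  rw [latticeInLevel_endoGL_sub_one_iff_isOrd hvρ hϖ jE φ hφs hφi hφγ hb hpr hB hg₀ hg₀1 hprg hBΛ hx₀ hY0 hΛx hw₀Y u 1, pow_one, pow_one]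
  refine ⟨hu1, ⟨?_, ?_⟩, ⟨?_, ?_⟩⟩
  · -- `|(lam − 1)∕ϖE| ≤ 1`
    have hsplit : lam - 1 = μ + (jE ((u : Matrix (Fin 1) (Fin 1) E) 0 0) - 1) := by rw [hμdef]; ring
    rw [Valuation.map_div, div_le_one₀ hvjϖpos, hsplit]
    exact (Valuation.map_add _ _ _).trans (max_le hμ1 hjum)
  · -- `|(lam − 1)∕ϖE − ρ(…)| ≤ |cc(α − ρα)|`
    have e : (lam - 1) / jE ϖ - ρ ((lam - 1) / jE ϖ) = (μ - ρ μ) / jE ϖ := by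
      rw [map_div₀, map_sub, map_one, hρϖ, hμdef, map_sub, hρu]; field_simp; ring
    rw [e, Valuation.map_div, div_le_iff₀ hvjϖpos]
    exact hanti1
  · -- `|μ∕(ϖE·Y)| ≤ 1`
    rw [show μ / (jE ϖ * Y) = μ / Y / jE ϖ by rw [mul_comm, div_div], Valuation.map_div, div_le_one₀ hvjϖpos]
    exact hμY1
  · -- `|μ∕(ϖE·Y) − ρ(…)| ≤ |cc(α − ρα)|`
    have e : μ / (jE ϖ * Y) - ρ (μ / (jE ϖ * Y)) = (μ / Y - ρ (μ / Y)) / jE ϖ := by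
      rw [map_div₀, map_div₀, map_mul, hρϖ]; field_simp
    rw [e, Valuation.map_div, div_le_iff₀ hvjϖpos]
    exact hsk

/-- **(X′) … HENCE OFF EVERY `ℓ₀ = 0` SHELL**: under the letters of `latticeInLevel_one_endoGL_sub_one_of_v_rayScalar_le`, `¬ LatticeNearTransvShell ϖ 0 m (Γ − 1) L` for every
square level `m` (the shell asks `¬ LatticeInLevel ϖ 1`). [cite: Kottwitz1986BaseChangeUnits, §3] [cite: Rogawski1990, §4.9 Prop. 4.9.1 (b) p. 55] -/
theorem not_latticeNearTransvShell_zero_of_v_rayScalar_le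
    (hρρ : ∀ x, ρ (ρ x) = x) (hvρ : ∀ x, Valued.v (ρ x) = Valued.v x) (hΘΘ : ∀ x, Θ (Θ x) = x) (hΘρ : ∀ x, Θ (ρ x) = ρ (Θ x))
    (hvΘ : ∀ x, Valued.v (Θ x) = Valued.v x) {ϖ : E} (hϖ : Valued.v ϖ = exp (-1 : ℤ))
    (jE : E →+* M) (hjv : ∀ c, Valued.v (jE c) ≤ 1 ↔ Valued.v c ≤ 1) (hjfix : ∀ z, ρ z = z ↔ ∃ c, jE c = z)
    (φ : (Fin 2 → E) →+ M) (hφs : ∀ (c : E) (x : Fin 2 → E), φ (c • x) = jE c * φ x) (hφi : Function.Injective φ)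
    {γ₂ : GL (Fin 2) E} {lam hM : M} (hφγ : ∀ x, φ ((γ₂ : Matrix (Fin 2) (Fin 2) E) *ᵥ x) = lam * φ x) (hhM : hM ≠ 0) (hΘh : Θ hM = hM)
    {L : Submodule 𝒪[E] (Fin 3 → E)} {b : ℕ} (hb : ∀ a : E, (Pi.single 1 a : Fin 3 → E) ∈ L ↔ Valued.v a ≤ Valued.v ϖ ^ b)
    (hpr : ∀ x ∈ L, Valued.v (x 1) * Valued.v ϖ ^ b ≤ 1)
    {B₂ : Submodule 𝒪[E] (Fin 2 → E)} {w₀ : Fin 2 → E} {g₀ : Fin 3 → E}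
    (hB : B₂.map ((Matrix.toLin' (!![1, 0; 0, 0; 0, 1] : Matrix (Fin 3) (Fin 2) E)).restrictScalars 𝒪[E]) =
      L ⊓ LinearMap.ker ((LinearMap.proj (1 : Fin 3) : (Fin 3 → E) →ₗ[E] E).restrictScalars 𝒪[E]))
    (hg₀ : g₀ ∈ L) (hg₀1 : Valued.v (g₀ 1) * Valued.v ϖ ^ b = 1) (hprg : g₀ - Pi.single 1 (g₀ 1) = ![w₀ 0, 0, w₀ 1])
    {Λ : AddSubgroup M} (hBΛ : B₂.toAddSubgroup.map φ = Λ) {cc x₀ : M} (hc : ρ cc = cc) (hcc : cc * (α - ρ α) ≠ 0) (hx₀ : x₀ ≠ 0)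
    (hΛx : ∀ x, x ∈ Λ ↔ ∃ z, IsOrd ρ α cc z ∧ x = x₀ * z) (hw₀Y : φ w₀ = (dualGen ρ Θ α cc hM x₀)⁻¹ * x₀)
    (u : GL (Fin 1) E) (hu1 : Valued.v ((u : Matrix (Fin 1) (Fin 1) E) 0 0 - 1) ≤ Valued.v ϖ)
    (hμ1 : Valued.v (lam - jE ((u : Matrix (Fin 1) (Fin 1) E) 0 0)) ≤ Valued.v (jE ϖ))
    (hanti1 : Valued.v ((lam - jE ((u : Matrix (Fin 1) (Fin 1) E) 0 0)) - ρ (lam - jE ((u : Matrix (Fin 1) (Fin 1) E) 0 0))) ≤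
      Valued.v (cc * (α - ρ α)) * Valued.v (jE ϖ))
    (hμY1 : Valued.v ((lam - jE ((u : Matrix (Fin 1) (Fin 1) E) 0 0)) / dualGen ρ Θ α cc hM x₀) ≤ Valued.v (jE ϖ))
    {e₀ : E} (he₀ : jE e₀ = (lam - jE ((u : Matrix (Fin 1) (Fin 1) E) 0 0)) / (cc * (α - ρ α) * Θ (dualGen ρ Θ α cc hM x₀)) +
      ρ ((lam - jE ((u : Matrix (Fin 1) (Fin 1) E) 0 0)) / (cc * (α - ρ α) * Θ (dualGen ρ Θ α cc hM x₀))))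
    (he₀le : Valued.v e₀ ≤ Valued.v ϖ) (m : ℕ) :
    ¬ LatticeNearTransvShell ϖ 0 m ((((endoGL (γ₂, u) : GL (Fin 3) E) : Matrix (Fin 3) (Fin 3) E) - 1)) L := fun h =>
  h.2.1 (latticeInLevel_one_endoGL_sub_one_of_v_rayScalar_le hρρ hvρ hΘΘ hΘρ hvΘ hϖ jE hjv hjfix φ hφs hφi hφγ hhM hΘh hb hpr hB hg₀ hg₀1 hprg hBΛ hc hcc hx₀
    hΛx hw₀Y u hu1 hμ1 hanti1 hμY1 he₀ he₀le)

/-! ## §3 (L, level) Level `0` always; a unit ray scalar forbids level `1` -/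

/-- **LEVEL `0` OF A CONE VERTEX**: `lam ∈ 𝒪_cc` and the population token `μ∕Y ∈ 𝒪_cc` (the cell's depth clause) give `LatticeInLevel ϖ 0 (Γ − 1) L` (all three clauses of ★
`latticeInLevel_endoGL_sub_one_iff_isOrd` at `ℓ = 0`; `|u₀₀| ≤ 1`). [cite: Kottwitz1986BaseChangeUnits, §3] [cite: Serre1979, Ch. III §6 Prop. 12] -/
theorem latticeInLevel_zero_endoGL_sub_one_of_isOrd
    (hvρ : ∀ x, Valued.v (ρ x) = Valued.v x) {ϖ : E} (hϖ : Valued.v ϖ = exp (-1 : ℤ))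
    (jE : E →+* M) (φ : (Fin 2 → E) →+ M) (hφs : ∀ (c : E) (x : Fin 2 → E), φ (c • x) = jE c * φ x) (hφi : Function.Injective φ)
    {γ₂ : GL (Fin 2) E} {lam hM : M} (hφγ : ∀ x, φ ((γ₂ : Matrix (Fin 2) (Fin 2) E) *ᵥ x) = lam * φ x) (hhM : hM ≠ 0)
    {L : Submodule 𝒪[E] (Fin 3 → E)} {b : ℕ} (hb : ∀ a : E, (Pi.single 1 a : Fin 3 → E) ∈ L ↔ Valued.v a ≤ Valued.v ϖ ^ b)
    (hpr : ∀ x ∈ L, Valued.v (x 1) * Valued.v ϖ ^ b ≤ 1)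
    {B₂ : Submodule 𝒪[E] (Fin 2 → E)} {w₀ : Fin 2 → E} {g₀ : Fin 3 → E}
    (hB : B₂.map ((Matrix.toLin' (!![1, 0; 0, 0; 0, 1] : Matrix (Fin 3) (Fin 2) E)).restrictScalars 𝒪[E]) =
      L ⊓ LinearMap.ker ((LinearMap.proj (1 : Fin 3) : (Fin 3 → E) →ₗ[E] E).restrictScalars 𝒪[E]))
    (hg₀ : g₀ ∈ L) (hg₀1 : Valued.v (g₀ 1) * Valued.v ϖ ^ b = 1) (hprg : g₀ - Pi.single 1 (g₀ 1) = ![w₀ 0, 0, w₀ 1])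
    {Λ : AddSubgroup M} (hBΛ : B₂.toAddSubgroup.map φ = Λ) {cc x₀ : M} (hcc : cc * (α - ρ α) ≠ 0) (hx₀ : x₀ ≠ 0)
    (hΛx : ∀ x, x ∈ Λ ↔ ∃ z, IsOrd ρ α cc z ∧ x = x₀ * z) (hw₀Y : φ w₀ = (dualGen ρ Θ α cc hM x₀)⁻¹ * x₀)
    (u : GL (Fin 1) E) (hu : Valued.v ((u : Matrix (Fin 1) (Fin 1) E) 0 0) ≤ 1) (hlam : IsOrd ρ α cc lam)
    (hP : IsOrd ρ α cc ((lam - jE ((u : Matrix (Fin 1) (Fin 1) E) 0 0)) / dualGen ρ Θ α cc hM x₀)) :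
    LatticeInLevel ϖ 0 ((((endoGL (γ₂, u) : GL (Fin 3) E) : Matrix (Fin 3) (Fin 3) E) - 1)) L := by
  have hY0 : dualGen ρ Θ α cc hM x₀ ≠ 0 := by
    rw [dualGen_def]; exact mul_ne_zero (mul_ne_zero hhM (mul_ne_zero hx₀ ((map_ne_zero Θ).2 hx₀))) hcc
  rw [latticeInLevel_endoGL_sub_one_iff_isOrd hvρ hϖ jE φ hφs hφi hφγ hb hpr hB hg₀ hg₀1 hprg hBΛ hx₀ hY0 hΛx hw₀Y u 0, pow_zero, pow_zero, div_one, one_mul]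
  refine ⟨?_, ?_, hP⟩
  · rw [Valuation.map_one]
    exact (Valuation.map_sub _ _ _).trans (max_le hu (le_of_eq (Valuation.map_one _)))
  · -- `lam − 1 ∈ 𝒪_cc`
    refine ⟨(Valuation.map_sub _ _ _).trans (max_le hlam.1 (le_of_eq (Valuation.map_one _))), ?_⟩
    rw [show lam - 1 - ρ (lam - 1) = lam - ρ lam by rw [map_sub, map_one]; ring]
    exact hlam.2

/-- **(L) «A VERTEX WITH `|e₀| = 1` IS NOT ON LEVEL `1`»**: `|μ∕Y − ρ(μ∕Y)| = |cc(α − ρα)| > |cc(α − ρα)|·|ϖE|`, so the third level-`1` clause of ★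
`latticeInLevel_endoGL_sub_one_iff_isOrd` fails. [cite: Kottwitz1986BaseChangeUnits, §3] [cite: Serre1979, Ch. III §6 Prop. 12] -/
theorem not_latticeInLevel_one_endoGL_sub_one_of_v_rayScalar_eq_one
    (hρρ : ∀ x, ρ (ρ x) = x) (hvρ : ∀ x, Valued.v (ρ x) = Valued.v x) (hΘΘ : ∀ x, Θ (Θ x) = x) (hΘρ : ∀ x, Θ (ρ x) = ρ (Θ x))
    (hvΘ : ∀ x, Valued.v (Θ x) = Valued.v x) {ϖ : E} (hϖ : Valued.v ϖ = exp (-1 : ℤ))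
    (jE : E →+* M) (hjv : ∀ c, Valued.v (jE c) ≤ 1 ↔ Valued.v c ≤ 1) (hjfix : ∀ z, ρ z = z ↔ ∃ c, jE c = z)
    (φ : (Fin 2 → E) →+ M) (hφs : ∀ (c : E) (x : Fin 2 → E), φ (c • x) = jE c * φ x) (hφi : Function.Injective φ)
    {γ₂ : GL (Fin 2) E} {lam hM : M} (hφγ : ∀ x, φ ((γ₂ : Matrix (Fin 2) (Fin 2) E) *ᵥ x) = lam * φ x) (hhM : hM ≠ 0) (hΘh : Θ hM = hM)
    {L : Submodule 𝒪[E] (Fin 3 → E)} {b : ℕ} (hb : ∀ a : E, (Pi.single 1 a : Fin 3 → E) ∈ L ↔ Valued.v a ≤ Valued.v ϖ ^ b)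
    (hpr : ∀ x ∈ L, Valued.v (x 1) * Valued.v ϖ ^ b ≤ 1)
    {B₂ : Submodule 𝒪[E] (Fin 2 → E)} {w₀ : Fin 2 → E} {g₀ : Fin 3 → E}
    (hB : B₂.map ((Matrix.toLin' (!![1, 0; 0, 0; 0, 1] : Matrix (Fin 3) (Fin 2) E)).restrictScalars 𝒪[E]) =
      L ⊓ LinearMap.ker ((LinearMap.proj (1 : Fin 3) : (Fin 3 → E) →ₗ[E] E).restrictScalars 𝒪[E]))
    (hg₀ : g₀ ∈ L) (hg₀1 : Valued.v (g₀ 1) * Valued.v ϖ ^ b = 1) (hprg : g₀ - Pi.single 1 (g₀ 1) = ![w₀ 0, 0, w₀ 1])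
    {Λ : AddSubgroup M} (hBΛ : B₂.toAddSubgroup.map φ = Λ) {cc x₀ : M} (hc : ρ cc = cc) (hcc : cc * (α - ρ α) ≠ 0) (hx₀ : x₀ ≠ 0)
    (hΛx : ∀ x, x ∈ Λ ↔ ∃ z, IsOrd ρ α cc z ∧ x = x₀ * z) (hw₀Y : φ w₀ = (dualGen ρ Θ α cc hM x₀)⁻¹ * x₀)
    (u : GL (Fin 1) E)
    {e₀ : E} (he₀ : jE e₀ = (lam - jE ((u : Matrix (Fin 1) (Fin 1) E) 0 0)) / (cc * (α - ρ α) * Θ (dualGen ρ Θ α cc hM x₀)) +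
      ρ ((lam - jE ((u : Matrix (Fin 1) (Fin 1) E) 0 0)) / (cc * (α - ρ α) * Θ (dualGen ρ Θ α cc hM x₀))))
    (he₀1 : Valued.v e₀ = 1) :
    ¬ LatticeInLevel ϖ 1 ((((endoGL (γ₂, u) : GL (Fin 3) E) : Matrix (Fin 3) (Fin 3) E) - 1)) L := by
  set Y : M := dualGen ρ Θ α cc hM x₀ with hYdef
  set μ : M := lam - jE ((u : Matrix (Fin 1) (Fin 1) E) 0 0) with hμdef
  have hvϖ0 : Valued.v ϖ ≠ 0 := by rw [hϖ]; exact exp_ne_zero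
  have hϖ0 : ϖ ≠ 0 := fun h0 => hvϖ0 (by rw [h0, map_zero])
  have hϖlt : Valued.v ϖ < 1 := by rw [hϖ, ← exp_zero, exp_lt_exp]; norm_num
  have hjϖ0 : jE ϖ ≠ 0 := (map_ne_zero jE).2 hϖ0
  have hvjϖpos : 0 < Valued.v (jE ϖ) := zero_lt_iff.2 ((Valuation.ne_zero_iff _).2 hjϖ0)
  have hjϖlt : Valued.v (jE ϖ) < 1 := by
    have h := v_map_le_pow_iff jE hjv hϖ0 ϖ 1
    rw [pow_one, pow_one] at h
    -- `|jEϖ| ≤ |ϖ| < 1`... use `hjv`-isometry on the unit ball: `|jE ϖ| < 1` iff not a unit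
    by_contra hge
    have hge' : 1 ≤ Valued.v (jE ϖ) := not_lt.1 hge
    have h1 : Valued.v (jE ϖ) ≤ 1 := (hjv ϖ).2 hϖlt.le
    have heq : Valued.v (jE ϖ) = 1 := le_antisymm h1 hge'
    -- then `|jE ϖ⁻¹| ≤ 1`, so `|ϖ⁻¹| ≤ 1`, contradiction
    have hinv : Valued.v (jE ϖ⁻¹) ≤ 1 := by rw [map_inv₀, map_inv₀, heq, inv_one]
    have hinv' : Valued.v ϖ⁻¹ ≤ 1 := (hjv _).1 hinv
    rw [map_inv₀, inv_le_one₀ (zero_lt_iff.2 hvϖ0)] at hinv'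
    exact absurd (lt_of_lt_of_le hϖlt hinv') (lt_irrefl _)
  have hρϖ : ρ (jE ϖ) = jE ϖ := (hjfix _).2 ⟨ϖ, rfl⟩
  have hY0 : Y ≠ 0 := by
    rw [hYdef, dualGen_def]; exact mul_ne_zero (mul_ne_zero hhM (mul_ne_zero hx₀ ((map_ne_zero Θ).2 hx₀))) hcc
  have hje₀ : Valued.v (jE e₀) = 1 := by
    have h := v_map_le_pow_iff jE hjv hϖ0 e₀ 0
    rw [pow_zero, pow_zero] at h
    refine le_antisymm (h.2 he₀1.le) ?_
    -- `|jE e₀| ≥ 1`: `e₀` is a unit, `jE e₀⁻¹` integral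
    have hinv : Valued.v (jE e₀⁻¹) ≤ 1 := (hjv _).2 (by rw [map_inv₀, he₀1, inv_one])
    have he0 : jE e₀ ≠ 0 := fun h0 => by
      rw [map_inv₀, h0, inv_zero, Valuation.map_zero] at hinv
      have : e₀ = 0 := (map_eq_zero jE).1 h0
      rw [this, map_zero] at he₀1; exact absurd he₀1 zero_ne_one
    rw [map_inv₀, map_inv₀, inv_le_one₀ (zero_lt_iff.2 ((Valuation.ne_zero_iff _).2 he0))] at hinv
    exact hinv
  -- the skew of `μ∕Y` has the FULL size `|cc(α − ρα)|`
  have hsk : Valued.v (μ / Y - ρ (μ / Y)) = Valued.v (cc * (α - ρ α)) := by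
    rw [← v_rayScalar_mul_eq hρρ hΘΘ hΘρ hvΘ hc hcc hΘh jE he₀, hje₀, one_mul]
  intro hlev
  rw [latticeInLevel_endoGL_sub_one_iff_isOrd hvρ hϖ jE φ hφs hφi hφγ hb hpr hB hg₀ hg₀1 hprg hBΛ hx₀ hY0 hΛx hw₀Y u 1, pow_one, pow_one] at hlev
  have h3 := hlev.2.2.2
  have e : μ / (jE ϖ * Y) - ρ (μ / (jE ϖ * Y)) = (μ / Y - ρ (μ / Y)) / jE ϖ := by
    rw [map_div₀, map_div₀, map_mul, hρϖ]; field_simp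
  rw [e, Valuation.map_div, div_le_iff₀ hvjϖpos, hsk] at h3
  have hpos : (0 : ℤᵐ⁰) < Valued.v (cc * (α - ρ α)) := zero_lt_iff.2 ((Valuation.ne_zero_iff _).2 hcc)
  have : Valued.v (cc * (α - ρ α)) * 1 ≤ Valued.v (cc * (α - ρ α)) * Valued.v (jE ϖ) := by rw [mul_one]; exact h3
  exact absurd (le_of_mul_le_mul_left this hpos) (not_le.2 hjϖlt)

/-! ## §4 (L, label) HEAD — the census letter is a `σ`-fixed-unit ray, from SIZES -/

/-- **HEAD — «THE RAY SCALAR OF A ROW VERTEX IS NEARLY `σ`-FIXED», FROM SIZES.**  LH4-p16's ★ HEAD `…RayScalarNearlyFixed.exists_fixed_unit_valueSet_endoGL_sub_one_glued_eq_smul_xPlus`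
VERBATIM in frame (★ p861372 HEAD B: plane `(E², H₂)`, block form `block(H₂, h_W)`, `Γ = endoGL (γ₂, u)`, ★ (C1)'s line model, an integral vertex `L` glued over `(B₂, w₀)` with
generator `g₀`, `Λ = x₀·𝒪_cc`, `φ w₀ = Y⁻¹x₀`; the sheet datum `IsRamifiedQuadraticDatum σ ϖ d t` on `E`; `Θlam·lam = 1`, `|lam| = 1`, `u₀₀·σu₀₀ = 1`; the POPULATION token
`μ∕Y ∈ 𝒪_cc`; the ray scalar `jE e₀ = Tr_ρ(μ∕D₀)` ON the `ℓ₀`-shell `|e₀| = |ϖ|^{d%2}`; three deep tokens at `n ≥ 3d − 2 + d%2`) and in conclusion — with the RAY-DOMINATION letters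
`hμ hμt hmm` REPLACED by `jE` isometric, the level `|Y| = |ϖE|^b` and LH7-p09's three μ-currency SIZES at `m*`: `g1 : |μ|·|ϖE|^{d−1} ≤ |α − ρα|·|ϖE|^b·|ϖE|^{m*}`,
`g2 : |μ|·|Θα − α| ≤ |α − ρα|·|ϖE|^b·|ϖE|^{m*}`, `g3 : |μ|·|cc| ≤ |α − ρα|·|ϖE|^b·|ϖE|^{m*}` (★ p863638: the norm-form letter is the ray by the TRACE IDEAL).  THEN there is a
`σ`-fixed unit `e′` with `|e₀ − e′·t₊| ≤ |ϖ|^{m*}` and the `ϖ^{m*}`-value set of `Γ − 1` on `L` is `valueSetMod σ ϖ m* (e′ • X₊)`.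
[cite: Jacobowitz1962, §4] [cite: Rogawski1990, §4.9 Prop. 4.9.1 (b) p. 55] [cite: Kottwitz1986BaseChangeUnits, §1 pp. 240–241] [cite: Serre1979, Ch. I §6 Prop. 18; Ch. III §3 Prop. 7; Ch. V §3 Cor. 3] -/
theorem exists_fixed_unit_valueSet_eq_smul_xPlus_of_sizes {σ : E →+* E} {ϖ : E} {d t : ℕ} (hD : IsRamifiedQuadraticDatum σ ϖ d t)
    (H₂ : Matrix (Fin 2) (Fin 2) E) (h : E)
    (jE : E →+* M) (hjv : ∀ c, Valued.v (jE c) ≤ 1 ↔ Valued.v c ≤ 1) (hjiso : ∀ c, Valued.v (jE c) = Valued.v c) (hjfix : ∀ z, ρ z = z ↔ ∃ c, jE c = z)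
    (hρρ : ∀ x, ρ (ρ x) = x) (hvρ : ∀ x, Valued.v (ρ x) = Valued.v x) (hα : ρ α ≠ α) (hα1 : Valued.v α ≤ 1)
    (hΘΘ : ∀ x, Θ (Θ x) = x) (hΘρ : ∀ x, Θ (ρ x) = ρ (Θ x)) (hvΘ : ∀ x, Valued.v (Θ x) = Valued.v x) (hΘj : ∀ c, Θ (jE c) = jE (σ c))
    (φ : (Fin 2 → E) →+ M) (hφs : ∀ (c : E) (x : Fin 2 → E), φ (c • x) = jE c * φ x)
    {γ₂ : GL (Fin 2) E} {lam hM : M} (hφγ : ∀ x, φ ((γ₂ : Matrix (Fin 2) (Fin 2) E) *ᵥ x) = lam * φ x) (hhM : hM ≠ 0) (hΘh : Θ hM = hM)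
    (hform : ∀ x y, jE (pairing σ H₂ x y) = hM * Θ (φ x) * φ y + ρ (hM * Θ (φ x) * φ y))
    {L : Submodule 𝒪[E] (Fin 3 → E)} {b : ℕ} (hpr : ∀ x ∈ L, Valued.v (x 1) * Valued.v ϖ ^ b ≤ 1)
    (hint : ∀ y ∈ L, Valued.v (pairing σ (!![H₂ 0 0, 0, H₂ 0 1; 0, h, 0; H₂ 1 0, 0, H₂ 1 1] : Matrix (Fin 3) (Fin 3) E) y y) ≤ 1)
    {B₂ : Submodule 𝒪[E] (Fin 2 → E)} {w₀ : Fin 2 → E} {g₀ : Fin 3 → E}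
    (hB : B₂.map ((Matrix.toLin' (!![1, 0; 0, 0; 0, 1] : Matrix (Fin 3) (Fin 2) E)).restrictScalars 𝒪[E]) =
      L ⊓ LinearMap.ker ((LinearMap.proj (1 : Fin 3) : (Fin 3 → E) →ₗ[E] E).restrictScalars 𝒪[E]))
    (hg₀ : g₀ ∈ L) (hg₀1 : Valued.v (g₀ 1) * Valued.v ϖ ^ b = 1) (hprg : g₀ - Pi.single 1 (g₀ 1) = ![w₀ 0, 0, w₀ 1])
    (u : GL (Fin 1) E)
    {cc x₀ : M} (hc : ρ cc = cc) (hc1 : Valued.v cc ≤ 1) (hcc : cc * (α - ρ α) ≠ 0) (hx₀ : x₀ ≠ 0)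
    {Λ : AddSubgroup M} (hBΛ : B₂.toAddSubgroup.map φ = Λ)
    (hΛx : ∀ x, x ∈ Λ ↔ ∃ ζ, IsOrd ρ α cc ζ ∧ x = x₀ * ζ) (hw₀Y : φ w₀ = (dualGen ρ Θ α cc hM x₀)⁻¹ * x₀)
    -- the cell member: integral, of level `b`
    (hYO : IsOrd ρ α cc (dualGen ρ Θ α cc hM x₀)) (hYb : Valued.v (dualGen ρ Θ α cc hM x₀) = Valued.v (jE ϖ) ^ b)
    -- the three ray-by-trace sizes at `m*`
    (g1 : Valued.v (lam - jE ((u : Matrix (Fin 1) (Fin 1) E) 0 0)) * Valued.v (jE ϖ) ^ (d - 1) ≤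
      Valued.v (α - ρ α) * Valued.v (jE ϖ) ^ b * Valued.v (jE ϖ) ^ mstarOfRecord d)
    (g2 : Valued.v (lam - jE ((u : Matrix (Fin 1) (Fin 1) E) 0 0)) * Valued.v (Θ α - α) ≤
      Valued.v (α - ρ α) * Valued.v (jE ϖ) ^ b * Valued.v (jE ϖ) ^ mstarOfRecord d)
    (g3 : Valued.v (lam - jE ((u : Matrix (Fin 1) (Fin 1) E) 0 0)) * Valued.v cc ≤
      Valued.v (α - ρ α) * Valued.v (jE ϖ) ^ b * Valued.v (jE ϖ) ^ mstarOfRecord d)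
    -- the line-model structure, the population token, the ray scalar on the `ℓ₀`-shell, the three deep tokens
    (hΘlam : Θ lam * lam = 1) (hvlam : Valued.v lam = 1)
    (huu : ((u : Matrix (Fin 1) (Fin 1) E) 0 0) * σ ((u : Matrix (Fin 1) (Fin 1) E) 0 0) = 1)
    (hP : IsOrd ρ α cc ((lam - jE ((u : Matrix (Fin 1) (Fin 1) E) 0 0)) / dualGen ρ Θ α cc hM x₀))
    {e₀ : E} (he₀ : jE e₀ = (lam - jE ((u : Matrix (Fin 1) (Fin 1) E) 0 0)) / (cc * (α - ρ α) * Θ (dualGen ρ Θ α cc hM x₀)) +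
      ρ ((lam - jE ((u : Matrix (Fin 1) (Fin 1) E) 0 0)) / (cc * (α - ρ α) * Θ (dualGen ρ Θ α cc hM x₀))))
    (he₀v : Valued.v e₀ = Valued.v ϖ ^ (d % 2)) {n : ℕ} (hn : 3 * d - 2 + d % 2 ≤ n)
    (hlamn : Valued.v (lam - 1) ≤ Valued.v (jE ϖ) ^ n) (hun : Valued.v ((u : Matrix (Fin 1) (Fin 1) E) 0 0 - 1) ≤ Valued.v ϖ ^ n)
    (hsk : Valued.v ((lam - jE ((u : Matrix (Fin 1) (Fin 1) E) 0 0)) / dualGen ρ Θ α cc hM x₀) * Valued.v (lam - ρ lam) ≤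
      Valued.v (jE ϖ) ^ n * Valued.v (cc * (α - ρ α))) :
    ∃ e' : E, σ e' = e' ∧ Valued.v e' = 1 ∧
      Valued.v (e₀ - e' * ((ϖ - σ ϖ) * ((ϖ * σ ϖ) ^ ((d - d % 2) / 2))⁻¹)) ≤ Valued.v ϖ ^ mstarOfRecord d ∧
      {z : E | ∃ y ∈ L, Valued.v ((ϖ ^ mstarOfRecord d)⁻¹ * (z - pairing σ (!![H₂ 0 0, 0, H₂ 0 1; 0, h, 0; H₂ 1 0, 0, H₂ 1 1] : Matrix (Fin 3) (Fin 3) E) y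
          ((((endoGL (γ₂, u) : GL (Fin 3) E) : Matrix (Fin 3) (Fin 3) E) - 1) *ᵥ y))) ≤ 1} =
        valueSetMod σ ϖ (mstarOfRecord d) (e' • xPlus σ ϖ d) := by
  obtain ⟨hσσ, hvσ, hϖ, -, hd, hd1, -⟩ := id hD
  have hvϖ0 : Valued.v ϖ ≠ 0 := by rw [hϖ]; exact exp_ne_zero
  have hϖ0 : ϖ ≠ 0 := fun h0 => by rw [h0, map_zero] at hvϖ0; exact hvϖ0 rfl
  have hϖ1 : Valued.v ϖ ≤ 1 := by rw [hϖ, ← exp_zero, exp_le_exp]; norm_num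
  have hm : mstarOfRecord d = d % 2 + 2 * d - 1 := rfl
  have hρj : ∀ c : E, ρ (jE c) = jE c := fun c => (hjfix _).2 ⟨c, rfl⟩
  -- Step A: `|e₀ + σe₀| ≤ |ϖ|^n`
  have hpos : (0 : ℤᵐ⁰) < Valued.v (cc * (α - ρ α)) := zero_lt_iff.2 ((Valuation.ne_zero_iff _).2 hcc)
  have hMside := v_map_add_mul_map_le σ jE hΘj hρj hρρ hvρ hΘΘ hΘρ hvΘ hc hcc hhM hΘh hx₀ hΘlam hvlam huu hP he₀
  have hMn : Valued.v (jE (e₀ + ((u : Matrix (Fin 1) (Fin 1) E) 0 0) * σ e₀)) ≤ Valued.v (jE ϖ) ^ n :=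
    hMside.trans (max_le hlamn ((div_le_iff₀ hpos).2 hsk))
  have hE : Valued.v (e₀ + σ e₀) ≤ Valued.v ϖ ^ n := v_add_map_le_of_map_le hvσ jE hjv hϖ0 hMn hun (by
    rw [he₀v]; exact pow_le_one₀ zero_le hϖ1)
  -- Step B: Eisenstein coordinates — the fixed unit `e′` at precision `(2d − 1) + d%2 = m*`
  obtain ⟨e', he'σ, he'1, hclose⟩ := exists_fixed_unit_sub_mul_refSkew_le_any hD (N := 2 * d - 1) (by omega) he₀v
    (hE.trans (pow_le_pow_right_of_le_one' hϖ1 (by omega)))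
  have hclose' : Valued.v (e₀ - e' * ((ϖ - σ ϖ) * ((ϖ * σ ϖ) ^ ((d - d % 2) / 2))⁻¹)) ≤ Valued.v ϖ ^ mstarOfRecord d :=
    hclose.trans (le_of_eq (by rw [hm]; congr 1; omega))
  refine ⟨e', he'σ, he'1, hclose', ?_⟩
  -- Step C: HEAD B, ★ p863638 (the ray by the trace ideal), (S0″)
  have hum : Valued.v ((u : Matrix (Fin 1) (Fin 1) E) 0 0 - 1) ≤ Valued.v (ϖ ^ mstarOfRecord d) := by
    rw [Valuation.map_pow]; exact hun.trans (pow_le_pow_right_of_le_one' hϖ1 (by rw [hm]; omega))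
  rw [valueSet_endoGL_sub_one_glued_eq_normFormSet_of_gen σ hϖ H₂ h jE hjv hΘΘ φ hφs hφγ hhM hform hpr hint hB hg₀ hg₀1 hprg u (mstarOfRecord d) hum hcc hx₀ hBΛ hΛx hw₀Y]
  simp_rw [mul_div_right_comm (lam - jE ((u : Matrix (Fin 1) (Fin 1) E) 0 0))]
  rw [normFormSet_eq_ray_of_line_sizes hρρ hvρ hα hα1 hvΘ σ hσσ hvσ hϖ hd jE hjv hjiso hΘj hjfix (trace_bound_pow_of_isRamifiedQuadraticDatum hD)
    hc1 hcc hYO hYb (mstarOfRecord d) g1 g2 g3 he₀]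
  -- `|e₀∕t₊ − e′| ≤ |ϖ|^{2d−1}`
  have hvt : Valued.v ((ϖ - σ ϖ) * ((ϖ * σ ϖ) ^ ((d - d % 2) / 2))⁻¹) = Valued.v ϖ ^ (d % 2) := v_refSkew_eq hvσ hϖ hd
  set tp : E := (ϖ - σ ϖ) * ((ϖ * σ ϖ) ^ ((d - d % 2) / 2))⁻¹ with htp
  have htp0 : tp ≠ 0 := fun h0 => by rw [h0, map_zero] at hvt; exact pow_ne_zero _ hvϖ0 hvt.symm
  have hge : Valued.v (e₀ * tp⁻¹ - e') ≤ Valued.v ϖ ^ (2 * d - 1) := by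
    have e : e₀ * tp⁻¹ - e' = tp⁻¹ * (e₀ - e' * tp) := by field_simp
    rw [e, Valuation.map_mul, map_inv₀, hvt, inv_mul_le_iff₀ (pow_pos (zero_lt_iff.2 hvϖ0) _), ← pow_add]
    exact hclose.trans (le_of_eq (by rw [add_comm]))
  exact valueSetMod_smul_xPlus_eq_of_v_sub_le_pred hvσ hϖ hd (show mstarOfRecord d ≤ (2 * d - 1) + d % 2 from by rw [hm]; omega) hge

end Summit.HodgeConjecture.HodgeConjecture.Cruxes.H413.F0P3cDyRamRowVertexRayDichotomy

end
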